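import Summits.CriticalPhenomena.SAWScalingLimit.Theses.SAWLoopFugacityFlow

/-!
# Sketch (crux-ideate, ideator 3): first lemmas for two crux ideas on `AvoidanceLimit`
(stmt-CriticalPhenomena-10649, route SAWLoopFugacityFlow).

* Card `ising-upper-jaw`: `IsingUpperJaw` (typed conjecture: the critical SAW avoidance probability
  is eventually bounded above by the free-b.c. critical Ising boundary two-point RATIO of the same
  nested pair) and the proved composition `upperHalfBound_of_jaw`:
  `IsingUpperJaw → IsingBoundaryRatio → UpperHalfBound` (limsup P_δ(avoid) ≤ d^{1/2}).
* Card `polymer-end-linear-response`: `killedPolygonMass` (x_c-mass of lattice polygons of `Ω_δ`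
  meeting the walk) and the typed statements `LinearResponseFinite` / `LinearResponseLaw`
  (first n-derivative of the route's two-leg ratio at the SAW end, predicted limit
  `(3/(8π))·log d`).
-/

noncomputable section

namespace Summit.CriticalPhenomena.SAWScalingLimit.Cruxes.AvoidanceLimit.Ideator3

open Literature.Probability.RandomPlanarGeometry Literature.Probability.LatticeModels
open MeasureTheory Filter Topology
open scoped ENNReal Classical

/-! ### Shared pieces -/

/-- The critical SAW avoidance probability `P_δ(range γ ⊆ closure D')` of the crux (as a real). -/
def sawAvoid (D D' : DobrushinDomain) (a b : ℝ → Site 2) (δ : ℝ) : ℝ :=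
  (((SAW.law D.carrier δ (a δ) (b δ)).map (fun γ => γ.curve))
      (CurveClass.rangeSubset (closure D'.carrier))).toReal

/-- The free-b.c. critical Ising boundary two-point ratio `⟨σ_a σ_b⟩_{Ω'_δ} / ⟨σ_a σ_b⟩_{Ω_δ}`
(the n = 1 anchor quantity of the route item `IsingBoundaryRatio`, same inline conventions). -/
def isingRatio (lf : ∀ (Ω : Set ℂ) (δ : ℝ), (discreteDomainGraph Ω δ).LocallyFinite)
    (D D' : DobrushinDomain) (a b : ℝ → Site 2) (δ : ℝ) : ℝ :=
  @isingTwoPoint _ (discreteDomainGraph D'.carrier δ) _ (lf D'.carrier δ)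
      (if h : Bornology.IsBounded D'.carrier ∧ 0 < δ then (meshDomain_finite h.1 h.2).toFinset else ∅)
      (Real.log (1 + Real.sqrt 2) / 2) 0 BoundaryCondition.free (a δ) (b δ) /
    @isingTwoPoint _ (discreteDomainGraph D.carrier δ) _ (lf D.carrier δ)
      (if h : Bornology.IsBounded D.carrier ∧ 0 < δ then (meshDomain_finite h.1 h.2).toFinset else ∅)
      (Real.log (1 + Real.sqrt 2) / 2) 0 BoundaryCondition.free (a δ) (b δ)

/-- The hull-subdomain frame of the crux: `D' ⊆ D`, same marked points, agreement in balls. -/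
def IsHullPair (D D' : DobrushinDomain) : Prop :=
  D'.carrier ⊆ D.carrier ∧ D'.pt 0 = D.pt 0 ∧ D'.pt 1 = D.pt 1 ∧
    ∃ ε : ℝ, 0 < ε ∧ D'.carrier ∩ Metric.ball (D.pt 0) ε = D.carrier ∩ Metric.ball (D.pt 0) ε ∧
      D'.carrier ∩ Metric.ball (D.pt 1) ε = D.carrier ∩ Metric.ball (D.pt 1) ε

/-! ### Card `ising-upper-jaw` -/

/-- ISING UPPER JAW (conjecture, asymptotic form): along every endpoint approximation living in
both `Ω_δ` and `Ω'_δ`, the critical SAW avoidance probability is eventually below the critical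
free-b.c. Ising boundary two-point ratio of the same nested pair, up to any `ε > 0`.
Finite-volume engine: GKS-II supermodularity of `log Z_Ising` over domains + the HT-strand
representation reduce it to monotonicity of `Ψ(U) = ⟨σ_aσ_b⟩_U / Z_SAW(U;a,b)` under `U' ⊆ U`. -/
def IsingUpperJaw : Prop :=
  ∀ (lf : ∀ (Ω : Set ℂ) (δ : ℝ), (discreteDomainGraph Ω δ).LocallyFinite)
    (D D' : DobrushinDomain) (a b : ℝ → Site 2),
    SAW.IsEndpointApprox D a b → SAW.IsEndpointApprox D' a b → IsHullPair D D' →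
    ∀ ε : ℝ, 0 < ε → ∀ᶠ δ in 𝓝[>] (0 : ℝ), sawAvoid D D' a b δ ≤ isingRatio lf D D' a b δ + ε

/-- The n = 1 anchor restated with the local abbreviations (it IS the route item, see
`isingBoundaryRatio_iff`). -/
def IsingAnchor : Prop :=
  ∀ (lf : ∀ (Ω : Set ℂ) (δ : ℝ), (discreteDomainGraph Ω δ).LocallyFinite)
    (D D' : DobrushinDomain) (a b : ℝ → Site 2),
    SAW.IsEndpointApprox D a b → SAW.IsEndpointApprox D' a b → IsHullPair D D' →
    ∀ (φ : ConformalEquiv UpperHalfPlane.upperHalfPlaneSet D.carrier), D.IsChordalUniformizing φ →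
    ∀ (A : Set ℂ), A = closure (UpperHalfPlane.upperHalfPlaneSet \
        {z | z ∈ UpperHalfPlane.upperHalfPlaneSet ∧ φ z ∈ D'.carrier}) →
    ∀ (Φ : ConformalEquiv (UpperHalfPlane.upperHalfPlaneSet \ A) UpperHalfPlane.upperHalfPlaneSet)
      (d : ℝ), IsRestrictionMap A Φ → HasRestrictionDeriv A Φ d →
    Tendsto (fun δ => isingRatio lf D D' a b δ) (𝓝[>] 0) (𝓝 (d ^ ((1 : ℝ) / 2)))

/-- The partial result the jaw buys: `limsup_δ P_δ(avoid) ≤ d^{1/2}` in `ε`-form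
("the SAW restriction exponent is at least 1/2"). -/
def UpperHalfBound : Prop :=
  ∀ (lf : ∀ (Ω : Set ℂ) (δ : ℝ), (discreteDomainGraph Ω δ).LocallyFinite)
    (D D' : DobrushinDomain) (a b : ℝ → Site 2),
    SAW.IsEndpointApprox D a b → SAW.IsEndpointApprox D' a b → IsHullPair D D' →
    ∀ (φ : ConformalEquiv UpperHalfPlane.upperHalfPlaneSet D.carrier), D.IsChordalUniformizing φ →
    ∀ (A : Set ℂ), A = closure (UpperHalfPlane.upperHalfPlaneSet \
        {z | z ∈ UpperHalfPlane.upperHalfPlaneSet ∧ φ z ∈ D'.carrier}) →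
    ∀ (Φ : ConformalEquiv (UpperHalfPlane.upperHalfPlaneSet \ A) UpperHalfPlane.upperHalfPlaneSet)
      (d : ℝ), IsRestrictionMap A Φ → HasRestrictionDeriv A Φ d →
    ∀ ε : ℝ, 0 < ε → ∀ᶠ δ in 𝓝[>] (0 : ℝ), sawAvoid D D' a b δ ≤ d ^ ((1 : ℝ) / 2) + ε

/-- The route's n = 1 anchor is literally `IsingAnchor` (definitional unfolding of the frame). -/
theorem isingAnchor_of_route
    (h : Summit.CriticalPhenomena.SAWScalingLimit.Theses.SAWLoopFugacityFlow.IsingBoundaryRatio) :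
    IsingAnchor := by
  intro lf D D' a b hab hab' hP φ hφ A hA Φ d hΦ hd
  obtain ⟨h1, h2, h3, h4⟩ := hP
  exact h lf D D' a b hab hab' h1 h2 h3 h4 φ hφ A hA Φ d hΦ hd

/-- COMPOSITION (proved): upper jaw + n = 1 anchor ⇒ `limsup P_δ(avoid) ≤ d^{1/2}`. -/
theorem upperHalfBound_of_jaw (hJ : IsingUpperJaw) (hI : IsingAnchor) : UpperHalfBound := by
  intro lf D D' a b hab hab' hP φ hφ A hA Φ d hΦ hd ε hε
  have hT := hI lf D D' a b hab hab' hP φ hφ A hA Φ d hΦ hd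
  have h1 : ∀ᶠ δ in 𝓝[>] (0 : ℝ), isingRatio lf D D' a b δ ≤ d ^ ((1 : ℝ) / 2) + ε / 2 :=
    hT.eventually (Iic_mem_nhds (by linarith))
  have h2 := hJ lf D D' a b hab hab' hP (ε / 2) (by linarith)
  filter_upwards [h1, h2] with δ hδ1 hδ2
  linarith

/-! ### Card `polymer-end-linear-response` -/

/-- `M_Ω(γ)`: the `x_c`-weighted mass of self-avoiding POLYGONS of `Ω_δ` that share a vertex with
the walk `γ` (each unrooted unoriented polygon of length `L` counted once: rooted oriented cycles
get weight `x_c^L/(2L)`). This is `SAP(Ω_δ) − SAP(Ω_δ ∖ γ)`, the first `n`-derivative of the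
loop dressing of the strand in the dilute loop gas (no osculations: the `w ≡ 0` direction). -/
def killedPolygonMass (Ω : Set ℂ) (δ : ℝ) {a b : Site 2} (γ : SAW.DomainSAW Ω δ a b) : ℝ :=
  ∑' c : (Σ u : Site 2, (discreteDomainGraph Ω δ).Walk u u),
    if c.2.IsCycle ∧ (∃ v ∈ c.2.support, v ∈ γ.walk.support) then
      SAW.criticalFugacity ^ c.2.length / (2 * (c.2.length : ℝ)) else 0

/-- Centred linear-response functional: expected killed-polygon mass minus `c` times expected
length under the critical SAW law of `(Ω_δ; a_δ, b_δ)`. -/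
def response (c : ℝ) (Ω : Set ℂ) (a b : ℝ → Site 2) (δ : ℝ) : ℝ :=
  ∫ γ, (killedPolygonMass Ω δ γ - c * (γ.length : ℝ)) ∂(SAW.law Ω δ (a δ) (b δ))

/-- LINEAR RESPONSE IS FINITE (conjecture; the `n = 0` corner of `FugacityAnalyticity` at first
order): ONE per-step renormalisation constant `c` (= `x_c'(0)/x_c`, the rate at which the walk
kills microscopic polygons) makes the difference of centred killed-polygon masses between the
nested domains bounded as `δ → 0⁺`, for every hull pair and endpoint approximation. -/
def LinearResponseFinite : Prop :=
  ∃ c : ℝ, ∀ (D D' : DobrushinDomain) (a b : ℝ → Site 2),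
    SAW.IsEndpointApprox D a b → SAW.IsEndpointApprox D' a b → IsHullPair D D' →
    ∃ C : ℝ, ∀ᶠ δ in 𝓝[>] (0 : ℝ),
      |response c D'.carrier a b δ - response c D.carrier a b δ| ≤ C

/-- LINEAR RESPONSE LAW (conjecture with a closed-form value): the same difference converges to
`(3/(8π)) · log d`, i.e. `d/dn log R_δ(n)|_{n=0} → b'(0) log d` with `b'(0) = −3/(8π)` read off
the dilute Coulomb-gas branch `b(κ) = (6−κ)/(2κ)`, `n = −2cos(4π/κ)` at `κ = 8/3`. -/
def LinearResponseLaw : Prop :=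
  ∃ c : ℝ, ∀ (D D' : DobrushinDomain) (a b : ℝ → Site 2),
    SAW.IsEndpointApprox D a b → SAW.IsEndpointApprox D' a b → IsHullPair D D' →
    ∀ (φ : ConformalEquiv UpperHalfPlane.upperHalfPlaneSet D.carrier), D.IsChordalUniformizing φ →
    ∀ (A : Set ℂ), A = closure (UpperHalfPlane.upperHalfPlaneSet \
        {z | z ∈ UpperHalfPlane.upperHalfPlaneSet ∧ φ z ∈ D'.carrier}) →
    ∀ (Φ : ConformalEquiv (UpperHalfPlane.upperHalfPlaneSet \ A) UpperHalfPlane.upperHalfPlaneSet)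
      (d : ℝ), IsRestrictionMap A Φ → HasRestrictionDeriv A Φ d →
    Tendsto (fun δ => response c D'.carrier a b δ - response c D.carrier a b δ)
      (𝓝[>] 0) (𝓝 ((3 / (8 * Real.pi)) * Real.log d))

/-- Trivial sanity composition: the law implies finiteness (a convergent real family is
eventually bounded). -/
theorem linearResponseFinite_of_law (h : LinearResponseLaw)
    (hφ : ∀ D : DobrushinDomain, ∃ φ : ConformalEquiv UpperHalfPlane.upperHalfPlaneSet D.carrier,
      D.IsChordalUniformizing φ)
    (hres : ∀ (D D' : DobrushinDomain) (φ : ConformalEquiv UpperHalfPlane.upperHalfPlaneSet D.carrier),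
      IsHullPair D D' → D.IsChordalUniformizing φ →
      ∃ (Φ : ConformalEquiv (UpperHalfPlane.upperHalfPlaneSet \
            closure (UpperHalfPlane.upperHalfPlaneSet \
              {z | z ∈ UpperHalfPlane.upperHalfPlaneSet ∧ φ z ∈ D'.carrier}))
            UpperHalfPlane.upperHalfPlaneSet) (d : ℝ),
        IsRestrictionMap _ Φ ∧ HasRestrictionDeriv _ Φ d) :
    LinearResponseFinite := by
  obtain ⟨c, hc⟩ := h
  refine ⟨c, fun D D' a b hab hab' hP => ?_⟩
  obtain ⟨φ, hφD⟩ := hφ D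
  obtain ⟨Φ, d, hΦ, hd⟩ := hres D D' φ hP hφD
  have hT := hc D D' a b hab hab' hP φ hφD _ rfl Φ d hΦ hd
  refine ⟨|(3 / (8 * Real.pi)) * Real.log d| + 1, ?_⟩
  have : ∀ᶠ δ in 𝓝[>] (0 : ℝ),
      dist (response c D'.carrier a b δ - response c D.carrier a b δ)
        ((3 / (8 * Real.pi)) * Real.log d) < 1 :=
    hT.eventually (Metric.ball_mem_nhds _ one_pos)
  filter_upwards [this] with δ hδ
  rw [Real.dist_eq] at hδ
  have := abs_sub_abs_le_abs_sub (response c D'.carrier a b δ - response c D.carrier a b δ)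
    ((3 / (8 * Real.pi)) * Real.log d)
  linarith

end Summit.CriticalPhenomena.SAWScalingLimit.Cruxes.AvoidanceLimit.Ideator3
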